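import Summits.QuantumFields.YangMills.Theorems.UnitScaleTiltProp7PinnedRegaugeChartDivergenceHR
import Summits.QuantumFields.YangMills.Theorems.UnitScaleTiltProp7PinnedRegaugeChartJunction
import Summits.QuantumFields.YangMills.Theorems.UnitScaleTiltProp7PlaquetteCurlComparison
import HarnessLib

/-!
# Prop 7 pinned re-gauge chart — the row `hR` of the (α′) knit IN THE DOOR'S LETTERS (composition of ✓p660134, ✓p660978, ✓p661419)

Route-R E′, path (α′), gap (P-bch-div) + junction S4′ of `stmt-QuantumFields-19200` (crux `MinimiserStabilityRegPr`), cell ym3-torus, width seat px15.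

THE STEP (integration of the px15 lineage).  ✓ `Prop7PinnedRegaugeChartDivergenceHR.divB_HS_sq_le_of_chartRemainder` gives the knit's row `hR` with a
θ₂ in the letters of the ratio field `Y`; ✓ `Prop7PinnedRegaugeChartJunction` converts the energies of `Y = e^{iD‴} − 1` into those of `iD‴`
(B9 letters), and ✓ `Prop7PlaquetteCurlComparison.curlHS_le_plaqK` converts the B9 curl energy into the door's plaquette form `K_W(iD‴)`.  Composed:

★★★ `divB_HS_sq_le_doorLetters` — for `T^{(i)}`, an `SU(N)` background `U₀` with `dist1(U₀(∂p)) ≤ a`, corrector `u` (`‖u − 1‖ ≤ σ`), chart `D‴`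
(`‖D‴_b‖ ≤ s`), covariant-difference data `δ` (`‖δ_b‖ ≤ ρ`), `σ, ρ ≤ 1∕256`, `s ≤ 1∕512`, and any `R` with `i·R_b = Φ♯(u(b.src), e^{iD‴_b}, δ_b)`:
`Σ_x‖(D*_W(i·R))(x)‖²_HS ≤ N·3d·[ (20(2s+ρ))²·4·Σ_b‖(D_W log u)(b)‖² + (10(σ+2s))²·Weitz_HS(δ)`
`  + (50(σ+ρ))²·( (2N + (8+2d)·N·(e^s−1)²)·( N·(2K_W(iD‴) + 32da²Σ‖D‴‖²) + DIV_HS(iD‴) + 2daN·Σ‖D‴‖² ) + 8daN·Σ‖D‴‖² ) ]`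
— every term is either a corrector energy (the knit's bookings) or one of the door's three letters `K_W(iD‴)`, `DIV_W(iD‴)`, `Σ‖D‴‖²`.
HONEST SCOPE.  Arithmetic composition of landed theorems; constants crude and ours; nothing of the cited papers is asserted.

References: T. Bałaban, CMP 102 (1985) 277–309 [Balaban1985Variational] ((47)–(48) pp.285–286, (135) p.298, (141)–(143) p.299); CMP 99 (1985) 389–434
[Balaban1985BackgroundPropagators] ((3.3)–(3.10) pp.390–392).
-/

set_option autoImplicit false

noncomputable section

open scoped BigOperators Matrix.Norms.L2Operator Matrix
open NormedSpace

namespace Summit.QuantumFields.YangMills.Theorems.Prop7PinnedRegaugeChartDoorLetters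

open Literature.MathematicalPhysics.QuantumFieldTheory.Balaban1983to89
open Finset B1RG242Torus
open MatrixLog (mlog)
open B9Eq39Adjoint (covD curl divB)
open B10Eq27TorusAxialLog (unitsField toUField)
open B9TorusCalculus (torusT)
open Summit.QuantumFields.YangMills.Theorems.Prop7PinnedRegaugeChartDivergenceHR (divB_HS_sq_le_of_chartRemainder)
open Summit.QuantumFields.YangMills.Theorems.Prop7PinnedRegaugeChartJunction (sum_norm_expm1_sq_le divHS_expm1_le curlHS_expm1_le)
open Summit.QuantumFields.YangMills.Theorems.Prop7PlaquetteCurlComparison (curlHS_le_plaqK)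

variable {P : Params} {N : ℕ} [NeZero N] {i : ℕ}

/-- ★★★ **THE ROW `hR` IN THE DOOR'S LETTERS** (composition of ✓p660134 ∘ ✓p661419 ∘ ✓p660978; see the module docstring for the display).
[cite: Balaban1985Variational, (135) p.298, (141)-(143) p.299] [cite: Balaban1985BackgroundPropagators, (3.8) p.392] -/
theorem divB_HS_sq_le_doorLetters (U₀ : GaugeField P i (Matrix.specialUnitaryGroup (Fin N) ℂ)) {a : ℝ} (ha : 0 ≤ a)
    (hU : ∀ p : Plaq P i, dist1 (GaugeField.plaqHol U₀ p) ≤ a)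
    (u : Site P i → Matrix.specialUnitaryGroup (Fin N) ℂ) (D δ R : PBond P i → Matrix (Fin N) (Fin N) ℂ) {σ s ρ : ℝ}
    (hσ : σ ≤ 1 / 256) (hs : s ≤ 1 / 512) (hρ : ρ ≤ 1 / 256)
    (hu : ∀ x, ‖(u x : Matrix (Fin N) (Fin N) ℂ) - 1‖ ≤ σ) (hD : ∀ b, ‖D b‖ ≤ s) (hδ : ∀ b, ‖δ b‖ ≤ ρ)
    (hR : ∀ (κ : Fin P.d) (z : Site P i), Complex.I • R ⟨z, κ⟩
        = mlog ((u z : Matrix (Fin N) (Fin N) ℂ) * exp (Complex.I • D ⟨z, κ⟩) * exp (-mlog (u z : Matrix (Fin N) (Fin N) ℂ) + δ ⟨z, κ⟩))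
          - (mlog (exp (Complex.I • D ⟨z, κ⟩)) + δ ⟨z, κ⟩)) :
    (∑ x : Site P i, ∑ j : Fin N, ∑ k : Fin N,
        ‖(divB (torusT P i) (fun κ z => unitsField (toUField U₀) ⟨z, κ⟩) (fun κ z => Complex.I • R ⟨z, κ⟩) x) j k‖ ^ 2)
      ≤ N * (3 * P.d * (
          (20 * (2 * s + ρ)) ^ 2 * (4 * ∑ b : PBond P i,
              ‖covD (torusT P i) (fun κ z => unitsField (toUField U₀) ⟨z, κ⟩) b.dir (fun z => mlog (u z : Matrix (Fin N) (Fin N) ℂ)) b.src‖ ^ 2)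
          + (10 * (σ + 2 * s)) ^ 2 * ((∑ x : Site P i, ∑ μ : Fin P.d, ∑ ν : Fin P.d,
              (if μ < ν then ∑ j : Fin N, ∑ k : Fin N,
                ‖(curl (torusT P i) (fun κ z => unitsField (toUField U₀) ⟨z, κ⟩) (fun κ z => δ ⟨z, κ⟩) μ ν x) j k‖ ^ 2 else 0)
            + ∑ x : Site P i, ∑ j : Fin N, ∑ k : Fin N,
                ‖(divB (torusT P i) (fun κ z => unitsField (toUField U₀) ⟨z, κ⟩) (fun κ z => δ ⟨z, κ⟩) x) j k‖ ^ 2)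
            + 2 * P.d * a * (N * ∑ b : PBond P i, ‖δ b‖ ^ 2))
          + (50 * (σ + ρ)) ^ 2 * (
              (2 * N + (8 + 2 * P.d) * N * (Real.exp s - 1) ^ 2) * (
                  N * (2 * (∑ p : Plaq P i, ‖((Complex.I • D ⟨p.src, p.μ⟩)
                      + ((U₀ ⟨p.src, p.μ⟩ : Matrix (Fin N) (Fin N) ℂ) * (Complex.I • D ⟨p.src.shift p.μ, p.ν⟩) * star (U₀ ⟨p.src, p.μ⟩ : Matrix (Fin N) (Fin N) ℂ))
                      - (((U₀ ⟨p.src, p.μ⟩ * U₀ ⟨p.src.shift p.μ, p.ν⟩ * (U₀ ⟨p.src.shift p.ν, p.μ⟩)⁻¹ : Matrix.specialUnitaryGroup (Fin N) ℂ) : Matrix (Fin N) (Fin N) ℂ)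
                          * (Complex.I • D ⟨p.src.shift p.ν, p.μ⟩)
                          * star ((U₀ ⟨p.src, p.μ⟩ * U₀ ⟨p.src.shift p.μ, p.ν⟩ * (U₀ ⟨p.src.shift p.ν, p.μ⟩)⁻¹ : Matrix.specialUnitaryGroup (Fin N) ℂ) : Matrix (Fin N) (Fin N) ℂ))
                      - (((GaugeField.plaqHol U₀ p : Matrix.specialUnitaryGroup (Fin N) ℂ) : Matrix (Fin N) (Fin N) ℂ) * (Complex.I • D ⟨p.src, p.ν⟩)
                          * star ((GaugeField.plaqHol U₀ p : Matrix.specialUnitaryGroup (Fin N) ℂ) : Matrix (Fin N) (Fin N) ℂ)))‖ ^ 2)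
                    + 32 * P.d * a ^ 2 * ∑ b : PBond P i, ‖D b‖ ^ 2)
                  + (∑ x : Site P i, ∑ j : Fin N, ∑ k : Fin N,
                      ‖(divB (torusT P i) (fun κ z => unitsField (toUField U₀) ⟨z, κ⟩) (fun κ z => Complex.I • D ⟨z, κ⟩) x) j k‖ ^ 2)
                  + 2 * P.d * a * (N * ∑ b : PBond P i, ‖D b‖ ^ 2))
              + 8 * P.d * a * N * ∑ b : PBond P i, ‖D b‖ ^ 2))) := by
  have hs1 : s ≤ 1 := by linarith
  have hτ : 2 * s ≤ 1 / 256 := by linarith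
  -- the ratio field `Y = e^{iD} − 1` and its sup row
  have hY : ∀ b : PBond P i, ‖exp (Complex.I • D b) - 1‖ ≤ 2 * s := by
    intro b
    have hI : ‖Complex.I • D b‖ = ‖D b‖ := by rw [norm_smul, Complex.norm_I, one_mul]
    have h1 := Literature.Analysis.Calculus.norm_exp_sub_one_le (Complex.I • D b)
    rw [hI] at h1
    have h2 : Real.exp ‖D b‖ - 1 ≤ 2 * ‖D b‖ := by
      have h := Real.abs_exp_sub_one_le (x := ‖D b‖) (by rw [abs_of_nonneg (norm_nonneg _)]; exact (hD b).trans hs1)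
      rw [abs_of_nonneg (norm_nonneg _)] at h
      exact (le_abs_self _).trans h
    linarith [hD b]
  have hR' : ∀ (κ : Fin P.d) (z : Site P i), Complex.I • R ⟨z, κ⟩
      = mlog ((u z : Matrix (Fin N) (Fin N) ℂ) * ((exp (Complex.I • D ⟨z, κ⟩) - 1) + 1) * exp (-mlog (u z : Matrix (Fin N) (Fin N) ℂ) + δ ⟨z, κ⟩))
          - (mlog ((exp (Complex.I • D ⟨z, κ⟩) - 1) + 1) + δ ⟨z, κ⟩) := fun κ z => by
    rw [sub_add_cancel]; exact hR κ z
  -- the four landed rows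
  have h0 := divB_HS_sq_le_of_chartRemainder U₀ ha hU u (fun b => exp (Complex.I • D b) - 1) δ R hσ hτ hρ hu hY hδ hR'
  have hC := curlHS_expm1_le U₀ ha hU D hD
  have hDv := divHS_expm1_le U₀ ha hU D hD
  have hM := sum_norm_expm1_sq_le D hs1 hD
  have hK := curlHS_le_plaqK U₀ hU D
  have hMZ : ∑ b : PBond P i, ‖Complex.I • D b‖ ^ 2 = ∑ b : PBond P i, ‖D b‖ ^ 2 :=
    Finset.sum_congr rfl fun b _ => by rw [norm_smul, Complex.norm_I, one_mul]
  rw [hMZ] at hC hDv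
  beta_reduce at h0
  -- non-negativity of the letters
  have hN : (0 : ℝ) ≤ N := Nat.cast_nonneg N
  have hd : (0 : ℝ) ≤ P.d := Nat.cast_nonneg P.d
  have hE : 0 ≤ (Real.exp s - 1) ^ 2 := sq_nonneg _
  have hCZ : 0 ≤ ∑ x : Site P i, ∑ μ : Fin P.d, ∑ ν : Fin P.d,
      (if μ < ν then ∑ j : Fin N, ∑ k : Fin N,
        ‖(curl (torusT P i) (fun κ z => unitsField (toUField U₀) ⟨z, κ⟩) (fun κ z => Complex.I • D ⟨z, κ⟩) μ ν x) j k‖ ^ 2 else 0) :=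
    Finset.sum_nonneg fun x _ => Finset.sum_nonneg fun μ _ => Finset.sum_nonneg fun ν _ => by
      split_ifs
      · exact Finset.sum_nonneg fun j _ => Finset.sum_nonneg fun k _ => sq_nonneg _
      · exact le_rfl
  have hDZ : 0 ≤ ∑ x : Site P i, ∑ j : Fin N, ∑ k : Fin N,
      ‖(divB (torusT P i) (fun κ z => unitsField (toUField U₀) ⟨z, κ⟩) (fun κ z => Complex.I • D ⟨z, κ⟩) x) j k‖ ^ 2 :=
    Finset.sum_nonneg fun x _ => Finset.sum_nonneg fun j _ => Finset.sum_nonneg fun k _ => sq_nonneg _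
  have hMD : 0 ≤ ∑ b : PBond P i, ‖D b‖ ^ 2 := Finset.sum_nonneg fun b _ => sq_nonneg _
  -- abbreviate the bracket `B(iD) = CURL + DIV + 2daN·M`
  set CZ := ∑ x : Site P i, ∑ μ : Fin P.d, ∑ ν : Fin P.d,
      (if μ < ν then ∑ j : Fin N, ∑ k : Fin N,
        ‖(curl (torusT P i) (fun κ z => unitsField (toUField U₀) ⟨z, κ⟩) (fun κ z => Complex.I • D ⟨z, κ⟩) μ ν x) j k‖ ^ 2 else 0) with hCZdef
  set DZ := ∑ x : Site P i, ∑ j : Fin N, ∑ k : Fin N,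
      ‖(divB (torusT P i) (fun κ z => unitsField (toUField U₀) ⟨z, κ⟩) (fun κ z => Complex.I • D ⟨z, κ⟩) x) j k‖ ^ 2 with hDZdef
  set MD := ∑ b : PBond P i, ‖D b‖ ^ 2 with hMDdef
  set CY := ∑ x : Site P i, ∑ μ : Fin P.d, ∑ ν : Fin P.d,
      (if μ < ν then ∑ j : Fin N, ∑ k : Fin N,
        ‖(curl (torusT P i) (fun κ z => unitsField (toUField U₀) ⟨z, κ⟩) (fun κ z => exp (Complex.I • D ⟨z, κ⟩) - 1) μ ν x) j k‖ ^ 2 else 0) with hCYdef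
  set DY := ∑ x : Site P i, ∑ j : Fin N, ∑ k : Fin N,
      ‖(divB (torusT P i) (fun κ z => unitsField (toUField U₀) ⟨z, κ⟩) (fun κ z => exp (Complex.I • D ⟨z, κ⟩) - 1) x) j k‖ ^ 2 with hDYdef
  set MY := ∑ b : PBond P i, ‖exp (Complex.I • D b) - 1‖ ^ 2 with hMYdef
  set KW := ∑ p : Plaq P i, ‖((Complex.I • D ⟨p.src, p.μ⟩)
      + ((U₀ ⟨p.src, p.μ⟩ : Matrix (Fin N) (Fin N) ℂ) * (Complex.I • D ⟨p.src.shift p.μ, p.ν⟩) * star (U₀ ⟨p.src, p.μ⟩ : Matrix (Fin N) (Fin N) ℂ))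
      - (((U₀ ⟨p.src, p.μ⟩ * U₀ ⟨p.src.shift p.μ, p.ν⟩ * (U₀ ⟨p.src.shift p.ν, p.μ⟩)⁻¹ : Matrix.specialUnitaryGroup (Fin N) ℂ) : Matrix (Fin N) (Fin N) ℂ)
          * (Complex.I • D ⟨p.src.shift p.ν, p.μ⟩)
          * star ((U₀ ⟨p.src, p.μ⟩ * U₀ ⟨p.src.shift p.μ, p.ν⟩ * (U₀ ⟨p.src.shift p.ν, p.μ⟩)⁻¹ : Matrix.specialUnitaryGroup (Fin N) ℂ) : Matrix (Fin N) (Fin N) ℂ))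
      - (((GaugeField.plaqHol U₀ p : Matrix.specialUnitaryGroup (Fin N) ℂ) : Matrix (Fin N) (Fin N) ℂ) * (Complex.I • D ⟨p.src, p.ν⟩)
          * star ((GaugeField.plaqHol U₀ p : Matrix.specialUnitaryGroup (Fin N) ℂ) : Matrix (Fin N) (Fin N) ℂ)))‖ ^ 2 with hKWdef
  clear_value CZ DZ MD CY DY MY KW
  -- the bracket and the Y-energies
  have h2da : (0 : ℝ) ≤ 2 * P.d * a := mul_nonneg (mul_nonneg (by norm_num) hd) ha
  have hdaNM : 0 ≤ 2 * P.d * a * (N * MD) := mul_nonneg h2da (mul_nonneg hN hMD)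
  have hB0 : 0 ≤ CZ + DZ + 2 * P.d * a * (N * MD) := by linarith only [hCZ, hDZ, hdaNM]
  have hWY : CY + DY + 2 * P.d * a * (N * MY)
      ≤ (2 * N + (8 + 2 * P.d) * N * (Real.exp s - 1) ^ 2) * (CZ + DZ + 2 * P.d * a * (N * MD)) + 8 * P.d * a * N * MD := by
    have h1 : 2 * P.d * a * (N * MY) ≤ 2 * P.d * a * (N * (4 * MD)) :=
      mul_le_mul_of_nonneg_left (mul_le_mul_of_nonneg_left hM hN) h2da
    have h2 : 0 ≤ 2 * N * (2 * P.d * a * (N * MD)) := mul_nonneg (mul_nonneg (by norm_num) hN) hdaNM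
    linarith only [hC, hDv, h1, h2, mul_nonneg (mul_nonneg hN hE) hB0]
  have hBZ : CZ + DZ + 2 * P.d * a * (N * MD) ≤ N * (2 * KW + 32 * P.d * a ^ 2 * MD) + DZ + 2 * P.d * a * (N * MD) := by linarith only [hK]
  have h8 : (0 : ℝ) ≤ 8 + 2 * P.d := by linarith
  have hcoef : 0 ≤ 2 * N + (8 + 2 * P.d) * N * (Real.exp s - 1) ^ 2 := by
    linarith only [mul_nonneg (mul_nonneg h8 hN) hE, hN]
  have hWY' : CY + DY + 2 * P.d * a * (N * MY)
      ≤ (2 * N + (8 + 2 * P.d) * N * (Real.exp s - 1) ^ 2) * (N * (2 * KW + 32 * P.d * a ^ 2 * MD) + DZ + 2 * P.d * a * (N * MD))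
        + 8 * P.d * a * N * MD := hWY.trans (by linarith only [mul_le_mul_of_nonneg_left hBZ hcoef])
  -- plug into `hR`
  have hc2 : 0 ≤ (50 * (σ + ρ)) ^ 2 := sq_nonneg _
  refine h0.trans ?_
  have h3d : (0 : ℝ) ≤ 3 * P.d := mul_nonneg (by norm_num) hd
  refine mul_le_mul_of_nonneg_left (mul_le_mul_of_nonneg_left ?_ h3d) hN
  linarith only [mul_le_mul_of_nonneg_left hWY' hc2]

end Summit.QuantumFields.YangMills.Theorems.Prop7PinnedRegaugeChartDoorLetters

end
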